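import Summits.ABC.ABC.Theses.FeketeScales

/-!
# `SparseGoodScales` (stmt-ABC-2161): normal form of the negation; vacuity of the un-windowed stub

Negative-side bookkeeping for the crux `Summit.ABC.ABC.Theses.FeketeScales.SparseGoodScales`
(cdisprove seat, cycle 1):

* `not_sparseGoodScales_iff` — WHAT A COUNTEREXAMPLE MUST BE: `¬ SparseGoodScales` iff some `δ₀ > 0` and
  a threshold `N` such that EVERY scale `R ≥ N` carries an abc triple with `rad ≤ R` and `R^{1+δ₀} < c`
  (a covering chain of triples of quality `> 1 + δ₀`; cf. `Negative/EveryScale.lean`, which realises such a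
  chain one logarithm lower, with `K·R < c` in place of `R^{1+δ₀} < c`).
* `windowed_trivial_of_le_one` — in the horizontal stub of line `Sketch`
  (`∀ δ>0 ∀ Λ>1 ∀ N ∃ R ≥ N ∀ abc, rad ≤ R → R < rad^Λ → c ≤ R^{1+δ}`) the side condition `1 < Λ` is what
  carries the content: for `Λ ≤ 1` the window `rad ≤ R < rad^Λ` is empty and the statement holds vacuously
  (for every `δ`).
-/

noncomputable section

namespace Summit.ABC.ABC.Theorems.SparseGoodScales.Negative

open Literature.NumberTheory.DiophantineGeometry UniqueFactorizationMonoid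

/-- **Normal form of `¬ SparseGoodScales`**: a fixed `δ₀ > 0` and a covering chain — beyond some `N`,
every scale `R` has an abc triple with `rad ≤ R` and `R^{1+δ₀} < c`. [folklore] -/
theorem not_sparseGoodScales_iff :
    ¬ Summit.ABC.ABC.Theses.FeketeScales.SparseGoodScales ↔
      ∃ δ : ℝ, 0 < δ ∧ ∃ N : ℕ, ∀ R : ℕ, N ≤ R →
        ∃ a b c : ℕ, IsABCTriple a b c ∧ rad a b c ≤ R ∧ (R : ℝ) ^ (1 + δ) < c := by
  constructor
  · intro h
    by_contra hne
    apply h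
    intro δ hδ N
    by_contra hR
    apply hne
    refine ⟨δ, hδ, N, fun R hNR => ?_⟩
    by_contra hT
    apply hR
    refine ⟨R, hNR, fun a b c ht hr => ?_⟩
    by_contra hc
    exact hT ⟨a, b, c, ht, hr, not_le.mp hc⟩
  · rintro ⟨δ, hδ, N, hN⟩ h
    obtain ⟨R, hNR, hR⟩ := h δ hδ N
    obtain ⟨a, b, c, ht, hr, hc⟩ := hN R hNR
    exact absurd (hR a b c ht hr) (not_le.mpr hc)

/-- **`1 < Λ` carries the content of the windowed stub**: for `Λ ≤ 1` (and any `δ`, `N`) the windowed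
good-scale statement holds vacuously, because `rad ≥ 1` makes `rad ≤ R < rad^Λ ≤ rad` impossible.
[folklore] -/
theorem windowed_trivial_of_le_one {Λ : ℝ} (hΛ : Λ ≤ 1) (δ : ℝ) (N : ℕ) :
    ∃ R : ℕ, N ≤ R ∧ ∀ a b c : ℕ, IsABCTriple a b c → rad a b c ≤ R →
      (R : ℝ) < ((rad a b c : ℕ) : ℝ) ^ Λ → (c : ℝ) ≤ (R : ℝ) ^ (1 + δ) := by
  refine ⟨max N 1, le_max_left _ _, fun a b c _ hr hwin => ?_⟩
  exfalso
  have hrad1 : (1 : ℝ) ≤ ((rad a b c : ℕ) : ℝ) := by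
    exact_mod_cast Nat.one_le_iff_ne_zero.mpr (by rw [rad_def]; exact radical_ne_zero)
  have h1 : ((rad a b c : ℕ) : ℝ) ^ Λ ≤ ((rad a b c : ℕ) : ℝ) ^ (1 : ℝ) :=
    Real.rpow_le_rpow_of_exponent_le hrad1 hΛ
  rw [Real.rpow_one] at h1
  have h2 : ((rad a b c : ℕ) : ℝ) ≤ ((max N 1 : ℕ) : ℝ) := by exact_mod_cast hr
  linarith

end Summit.ABC.ABC.Theorems.SparseGoodScales.Negative
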